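import Literature.AlgebraicGeometry.Resolution.OrderReductionThreefoldsAlgClosed
import Literature.AlgebraicGeometry.Resolution.HironakaDirectrix
import Mathlib.Logic.Relation
import HarnessLib

/-!
# Resolution data `(E⁺, E⁻, I, V)` on nonsingular threefolds, permissible transforms, and the "stable form" of Cutkosky 2009, Thm. 7.2 (definitions only)

Topic: `Literature/AlgebraicGeometry/Resolution`. DEFINITIONS (no named fact, no theorem of the
source is asserted) transcribing, on schemes and in the vocabulary of `MarkedIdeals.lean` /
`OrderReductionThreefoldsAlgClosed.lean` (the named fact `Cutkosky2009_thm_5_6`), the bookkeeping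
of S. D. Cutkosky, *Resolution of singularities for 3-folds in positive characteristic*, Amer. J.
Math. **131** (2009) 59–127 [Cutkosky2009], read in the held author version
(`paper:doi-10-1353-ajm-0-0036`; "pNN Lmm" = page NN, line mm of its text layer):

* **Def. 5.4** (p18 L32–45): "A resolution datum `R = (E⁺, E⁻, I, V)` is a 4-tuple where `E⁺` and
  `E⁻` are effective divisors on a nonsingular variety `V` over an algebraically closed field `k`,
  such that `E = E⁺ + E⁻` is a SNC divisor, `E⁺` and `E⁻` have no common components, and `I` is
  an ideal sheaf on `V`. For `t ≥ 1`, let `Sing_t(R) = Sing_t(I) = {p ∈ V | ν_p(I) ≥ t}`. … Let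
  `r = ν(R) = ν(I) = max{ν_p(I) | p ∈ V}`. For `p ∈ V`, let `η(p) =` the number of components of
  `E⁻` containing `p`."
* **Def. 5.5** (p18 L47–48) and the transform (p19 L5–9): "A permissible transform of `R` is the
  blow up `π_1 : V_1 → V` of a nonsingular subvariety `Y ⊂ Sing_r(R)` such that `Y` is transversal
  to `E = E⁺ + E⁻`. … We define the transform `R_1` of `R` on `V_1` to be `R_1 = (E_1⁺, E_1⁻, I_1,
  V_1)` where `I_1` is the weak transform of `I`, and `E_1⁺ = π_1^*(E⁺) + F`, `E_1⁻ =` the strict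
  transform of `E⁻` if `ν(I_1) = ν(R)`, `E_1⁺ = ∅`, `E_1⁻ = π_1^*(E⁺ + E⁻) + F` if `ν(I_1) < ν(R)`."
* **Thm. 7.2** (p21 L15–21): "Let `R = (∅, E, I, V)`. Then there exists a sequence of permissible
  transforms `π : V_1 → V` such that if `R_1` is the transform of `R` on `V_1`, then
  1. `Sing_r(R_1) ∩ E_1⁻ = ∅`, so that `η(p) = 0` for `p ∈ Sing_r(R_1)`.
  2. `Sing_r(R_1) ⊂ E_1⁺` and `dim Sing_r(R_1) ≤ 1`.
  3. All irreducible curves `C ⊂ Sing_r(R_1)` are nonsingular.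
  4. If `p ∈ Sing_r(R_1)`, then there exists an approximate hypersurface `D_p` of `I_1` at `p` which
     is transversal to `E_1⁺` and is not a component of `E_1⁺`."
  with "approximate hypersurface" (p18 L21–22): "A nonsingular hypersurface `D_p ⊂ Spec(𝒪_{V,p})` is
  called an approximate hypersurface to `I` at `p` if `D_p` contains an approximate manifold `M_p` to
  `I` at `p`", `M_p = V(T)` for "the smallest linear subspace `T` of the `k`-subspace spanned by
  `x_1, …, x_n` … such that `L ∈ k[T]` for all `f ∈ I_p`" (p17 L35–40), `L` the `r`-leading form.
* §8 (p24 L5–39): the standing situation of algorithms (9)/(10) — "the conclusions of Theorem 7.2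
  hold (but we now have `R = (E⁺, E⁻, I, V)`)", "`Sing_r(R)` is a finite set".

These are the `Datum` / `Reach` / `Resolved` / `Stable` / `FinSing` slots of the ABSTRACT signature
`Literature.AlgebraicGeometry.Cutkosky2009.DatumReduction.Sig56` (the typed proof skeleton of §§5–11,
`thm56_of_nodes`), now given their GEOMETRIC meaning, so that the theorems of §§7–8 can be stated as
named facts in the shape of that skeleton's nodes `Node.Thm72` / `Node.Alg9`
(`ThreefoldResolutionStableForm.lean`). Nothing here is specific to the Hironaka adjudication; the
source is a refereed published paper.

## Content (all DEFINITIONS; the few `theorem`s are unfolding / bookkeeping, proved)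

* `Cutkosky2009.ResDatum k` — a resolution datum `(E⁺, E⁻, I, V)` on a nonsingular quasi-projective
  threefold `V` over the algebraically closed field `k` TOGETHER WITH the integer `r ≥ 1` of Thm. 5.6
  (`ν(R) ≤ r`; `r = ν` of the original datum — the convention of `Sig56`), the standing hypotheses of
  §§5–8 (p17 L8–9, p20 L85–88) being fields: `V` integral, immersed in some `ℙⁿ_k`, all local rings
  regular, `dim V = 3`; `I ≠ 0`; `E⁺`, `E⁻` lists of ideal sheaves of smooth divisors with
  `HasSNC (E⁺ ++ E⁻)` and no common member.
* `ResDatum.singR` (`Sing_r(R)`), `ResDatum.nu` (`ν(I) = max ν_p(I)`), `ResDatum.Resolved`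
  (`Sing_r(R) = ∅`), `ResDatum.FinSing` (`Sing_r(R)` finite), `ResDatum.IsPermissible C` (Def. 5.5, with `C ≠ ⊤`:
  regular centre inside `Sing_r(R)` with snc with `E⁺ + E⁻`).
* `ResDatum.IsTransform R R' C τ` — `R'` IS the transform of `R` along the blow-up `τ : V' → V` of
  the permissible centre `C` (weak transform of `I` = controlled transform with exponent `r`, as in
  `Cutkosky2009_thm_5_6`; the TWO cases of the `E^±` rule); `ResDatum.Step`, `ResDatum.Reach` (finite
  sequences of permissible transforms: the reflexive–transitive closure).
* `ResDatum.IsApproxHypersurfaceTransversal R x` — the expansion-free rendering of Thm. 7.2 (4) at a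
  point `x`; `ResDatum.Stable R` — conclusions (1)–(4) of Thm. 7.2.
* `ResDatum.eta` (`η(p)`), `ResDatum.IsPointCentre`, `ResDatum.IsCurveCentre` (the two kinds of
  centres of §8 (9)), `Cutkosky2009.Run k` (an infinite run of permissible transforms with its centres
  and maps as data; `Run.reach`) — the carriers of the PROCEDURAL statements of §§7–8.

## Faithfulness notes

* Divisors are recorded by the ideal sheaves of their (smooth) components, multiplicities dropped,
  exactly as in `MarkedIdeals.lean` / `Cutkosky2009_thm_5_6`; "no common components" = no ideal sheaf
  other than the unit one occurs in both lists; `η(p) = 0 ∀ p ∈ Sing_r` is written as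
  `Sing_r ∩ Supp E⁻ = ∅` (the printed form of (1)).
* Def. 5.5 says "nonsingular subvariety `Y`" (irreducible); §8 (10) blows up "the union of one
  dimensional components of `Sing_r(I_n)`" resp. "`Sing_r(I_n)`, which is a finite union of points"
  and calls these permissible transforms (p24 L40–47), so centres are allowed to be REGULAR (possibly
  disconnected), as in `IsMultipleBlowup`.
* "`ν(I_1) = ν(R)`" in the `E^±` rule compares the maximal orders of `I_1` and of `I` (p18 L40
  `ν(R) = ν(I)`); both are rendered by `ResDatum.nu`, a supremum in `ℕ∞`.
* Thm. 7.2 (4), "there exists an approximate hypersurface `D_p = V(f)` of `I` at `p` transversal to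
  `E⁺` and not a component of `E⁺`", is rendered WITHOUT power series: there is a regular system of
  parameters `u` of `𝒪_{V,p}` and an index `i₀` such that (a) every member of `E⁺` through `p` is
  cut out at `p` by some `u_j` with `j ≠ i₀`, distinct members by distinct `j` (this is "`V(u_{i₀})`
  is transversal to `E⁺`", p16 L48–51, "and is not a component of `E⁺`"), and (b) the coordinate
  linear form `X_{i₀}` lies in the directrix `T(cl_r(I_p))` of the degree-`r` initial forms of `I_p`
  in the coordinates `u` (`HironakaDirectrix.lean`: `initialForms`, `directrix` = the smallest `T`
  with `cl_r ⊆ k[T]`, i.e. Cutkosky's `T`, p17 L35–40) — which says exactly that the nonsingular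
  hypersurface germ `V(u_{i₀})` contains the approximate manifold `M_p = V(T)` built on the
  parameters `u` (p18 L21–22). Quantified over CLOSED points `p ∈ Sing_r` (approximate manifolds
  live in `k⟦x_1, …, x_n⟧ = 𝒪̂_{V,p}`, p17 L29–31, i.e. at `k`-rational points).
* "`dim Sing_r(R_1) ≤ 1`" = topological Krull dimension of the closed subset; "all irreducible curves
  `C ⊂ Sing_r(R_1)` are nonsingular" = every irreducible closed one-dimensional `C ⊆ Sing_r` is a
  regular scheme with its reduced structure.

AI transcription; AI review is weaker than expert review.

## References

* S. D. Cutkosky, Amer. J. Math. 131 (2009): Def. 5.4, Def. 5.5 (p. 18), p. 19 l. 5–9, Thm. 7.2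
  (p. 21), §8 (p. 24) of the author version. [Cutkosky2009]
* V. Cossart, O. Piltant, J. Algebra 320 (2008), proof of Prop. 4.2 (directrix). [CossartPiltant2008]
-/

noncomputable section

open CategoryTheory AlgebraicGeometry TopologicalSpace IsLocalRing

namespace Literature.AlgebraicGeometry.Resolution

universe u

namespace Cutkosky2009

variable (k : Type u) [Field k]

/-- **A resolution datum `R = (E⁺, E⁻, I, V)` on a nonsingular quasi-projective threefold over the
algebraically closed field `k`, together with the integer `r ≥ 1` of Thm. 5.6** (Def. 5.4, p18
L32–45, with the standing hypotheses of §§5–8: `V` a nonsingular 3-fold = integral, immersed in some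
`ℙⁿ_k`, regular local rings, `dim V = 3`, p16 L12–14 / p17 L8–9 / p20 L85–88; `I` nonzero; `E⁺`,
`E⁻` with `E⁺ + E⁻` SNC and no common component; `ν(R) ≤ r`). Divisors are the lists of the ideal
sheaves of their components (`MarkedIdeals.lean`); "`k` algebraically closed" is imposed where the
theorems about these data are stated (`ThreefoldResolutionStableForm.lean`). [cite: Cutkosky2009, Def. 5.4 (author version p. 18 l. 32–45)] -/
structure ResDatum where
  /-- the ambient nonsingular threefold `V` -/
  V : Scheme.{u}
  /-- `V ⊆ ℙⁿ_k`: the projective space … -/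
  n : ℕ
  /-- … and the immersion ("variety = open subset of an integral closed subscheme of `ℙⁿ`") -/
  ι : V ⟶ (Motives.projectiveSpace n k).left
  isImmersion : IsImmersion ι
  isIntegral : IsIntegral V
  /-- nonsingular: all local rings regular -/
  isRegular : Scheme.IsRegular V
  /-- a 3-fold -/
  dim_eq : topologicalKrullDim V = 3
  /-- the divisor `E⁺` (its components) -/
  Eplus : List V.IdealSheafData
  /-- the divisor `E⁻` (its components) -/
  Eminus : List V.IdealSheafData
  /-- `E = E⁺ + E⁻` is a SNC divisor -/
  hasSNC : HasSNC (Eplus ++ Eminus)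
  /-- `E⁺` and `E⁻` have no common components -/
  no_common : ∀ D ∈ Eplus, D ∈ Eminus → D = ⊤
  /-- the ideal sheaf `I` -/
  ideal : V.IdealSheafData
  /-- `I ≠ 0` -/
  ideal_ne_bot : ideal ≠ ⊥
  /-- the integer `r` of Thm. 5.6 (`r = ν` of the original datum) -/
  r : ℕ
  one_le_r : 1 ≤ r
  /-- `ν(R) ≤ r`: no point has order `> r` -/
  ord_le : ∀ x : V, idealOrder ideal x ≤ r

namespace ResDatum

variable {k}

/-- The boundary `E = E⁺ + E⁻` (as the list of its components). [cite: Cutkosky2009, Def. 5.4 (p. 18 l. 34)] -/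
def boundary (R : ResDatum k) : List R.V.IdealSheafData :=
  R.Eplus ++ R.Eminus

/-- The marked ideal `(I, E⁺ + E⁻, r)` of the datum (the object of `Cutkosky2009_thm_5_6`).
[cite: Cutkosky2009, Def. 5.4 (p. 18)] -/
def marked (R : ResDatum k) : MarkedIdeal R.V :=
  ⟨R.ideal, R.boundary, R.r⟩

/-- **`Sing_r(R) = Sing_r(I) = {p ∈ V | ν_p(I) ≥ r}`.** [cite: Cutkosky2009, Def. 5.4 (p. 18 l. 37)] -/
def singR (R : ResDatum k) : Set R.V :=
  {x | (R.r : ℕ∞) ≤ idealOrder R.ideal x}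

/-- `Sing_r(R)` is the support of the marked ideal `(I, E, r)`. [cite: Cutkosky2009, Def. 5.4 (p. 18 l. 37)] -/
theorem singR_eq_support (R : ResDatum k) : R.singR = R.marked.support := rfl

/-- **`ν(I) = max{ν_p(I) | p}`** of an ideal sheaf (p18 L40 "`r = ν(R) = ν(I) = max{ν_p(I) | p ∈ V}`"),
as a supremum in `ℕ∞`. [cite: Cutkosky2009, Def. 5.4 (p. 18 l. 40)] -/
def nu {X : Scheme.{u}} (I : X.IdealSheafData) : ℕ∞ :=
  ⨆ x : X, idealOrder I x

/-- `ν(R) ≤ r`. [cite: Cutkosky2009, Def. 5.4 (p. 18 l. 40)] -/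
theorem nu_le (R : ResDatum k) : nu R.ideal ≤ R.r :=
  iSup_le R.ord_le

/-- **`Sing_r(R) = ∅`** — the datum is resolved (the conclusion of Thm. 5.6). [cite: Cutkosky2009, Thm. 5.6 (p. 19 l. 15)] -/
def Resolved (R : ResDatum k) : Prop :=
  R.singR = ∅

/-- **"`Sing_r(R)` is a finite set"** (§8, p24 L28 / L38). [cite: Cutkosky2009, §8 (p. 24 l. 28–38)] -/
def FinSing (R : ResDatum k) : Prop :=
  R.singR.Finite

/-- **Permissible centre (Def. 5.5, p18 L47–48)**: a NONEMPTY ("subvariety", p16 L12–14: a variety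
is an open subset of an integral closed subscheme of `ℙⁿ`; so `C ≠ ⊤`, i.e. `V(C) ≠ ∅`) regular
closed subscheme `Y = V(C) ⊆ Sing_r(R)` having simple normal crossings with ("transversal to",
p16 L48–51) `E = E⁺ + E⁻`. Regular, possibly disconnected, centres are allowed (the centres of §8
(10) are unions of points / of curves, p24 L40–47); the unit ideal is NOT (the blow-up of `⊤` is the
identity and would make every "no infinite sequence of permissible transforms" statement false).
[cite: Cutkosky2009, Def. 5.5 (p. 18 l. 47–48)] -/
def IsPermissible (R : ResDatum k) (C : R.V.IdealSheafData) : Prop :=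
  C ≠ ⊤ ∧ Scheme.IsRegular C.subscheme ∧ (C.support : Set R.V) ⊆ R.singR ∧
    HasSNCWith R.boundary C

/-- A permissible centre has nonempty support `V(C) ≠ ∅` (Def. 5.5: "subvariety"). [cite: Cutkosky2009, Def. 5.5 (p. 18 l. 47–48)] -/
theorem IsPermissible.support_nonempty {R : ResDatum k} {C : R.V.IdealSheafData}
    (h : R.IsPermissible C) : (C.support : Set R.V).Nonempty := by
  rw [Set.nonempty_iff_ne_empty]
  intro he
  exact h.1 (C.support_eq_bot_iff.mp (TopologicalSpace.Closeds.ext he))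

/-- A permissible centre lies in `Sing_r(R)`; in particular `Sing_r(R) ≠ ∅`, so a resolved datum admits
no permissible transform. [cite: Cutkosky2009, Def. 5.5 (p. 18 l. 47–48)] -/
theorem IsPermissible.singR_nonempty {R : ResDatum k} {C : R.V.IdealSheafData}
    (h : R.IsPermissible C) : R.singR.Nonempty :=
  h.support_nonempty.mono h.2.2.1

/-- **`R'` is the transform of `R` by the permissible transform `τ : V' → V` blowing up `C`**
(p19 L5–9): `τ` is a blow-up of `V` along the permissible centre `C`; `r` is kept; `I'` is the weak
transform of `I` — the controlled transform `𝒪(−rF)⁻¹ τ^*I` with exponent `r`, since the order of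
`I` along a permissible centre is exactly `r` (as in `Cutkosky2009_thm_5_6`); and, with `F` the
exceptional divisor and `D'` the strict transform of a component `D`:
if `ν(I') = ν(I)` then `E'⁺ = (E⁺)' + F`, `E'⁻ = (E⁻)'`; if `ν(I') ≠ ν(I)` (the order dropped —
printed "`ν(I_1) < ν(R)`"; `ν(I_1) > ν(R)` does not occur for a permissible transform, Lemma 5.1 (1),
p17 L49) then `E'⁺ = ∅`, `E'⁻ = (E⁺ + E⁻)' + F`. [cite: Cutkosky2009, Def. 5.5 and p. 19 l. 5–9] -/
def IsTransform (R R' : ResDatum k) (C : R.V.IdealSheafData) (τ : R'.V ⟶ R.V) : Prop :=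
  IsBlowup τ C ∧ R.IsPermissible C ∧ R'.r = R.r ∧
    R'.ideal = controlledTransform τ C R.ideal R.r ∧
    (nu (controlledTransform τ C R.ideal R.r) = nu R.ideal →
      R'.Eplus = R.Eplus.map (strictTransformIdeal τ C) ++ [C.comap τ] ∧
      R'.Eminus = R.Eminus.map (strictTransformIdeal τ C)) ∧
    (nu (controlledTransform τ C R.ideal R.r) ≠ nu R.ideal →
      R'.Eplus = [] ∧
      R'.Eminus = (R.Eplus ++ R.Eminus).map (strictTransformIdeal τ C) ++ [C.comap τ])

/-- One permissible transform: `R'` is the transform of `R` along SOME blow-up of SOME permissible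
centre. [cite: Cutkosky2009, Def. 5.5 and p. 19 l. 5–9] -/
def Step (R R' : ResDatum k) : Prop :=
  ∃ (C : R.V.IdealSheafData) (τ : R'.V ⟶ R.V), IsTransform R R' C τ

/-- A resolved datum (`Sing_r(R) = ∅`) admits no permissible transform: every permissible centre is a
nonempty subscheme of `Sing_r(R)` (Def. 5.5). [cite: Cutkosky2009, Def. 5.5 (p. 18 l. 47–48)] -/
theorem Resolved.not_step {R R' : ResDatum k} (h : R.Resolved) : ¬ Step R R' := by
  rintro ⟨C, τ, hT⟩
  have hne := hT.2.1.singR_nonempty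
  rw [Resolved] at h
  rw [h] at hne
  exact Set.not_nonempty_empty hne

/-- **`R'` is reached from `R` by a (finite, possibly empty) sequence of permissible transforms**
(p19 L13–16 "a sequence of permissible transforms `π : V_1 → V` of `R` … `R_1` the transform of `R`
by `π`"): the reflexive–transitive closure of `Step`. [cite: Cutkosky2009, Thm. 5.6 (p. 19 l. 13–16, l. 24–27)] -/
def Reach (R R' : ResDatum k) : Prop :=
  Relation.ReflTransGen Step R R'

/-- `Reach` is reflexive (the empty sequence of permissible transforms). [cite: Cutkosky2009, Thm. 5.6 (p. 19 l. 13–16, l. 24–27: sequences of permissible transforms)] -/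
theorem Reach.refl (R : ResDatum k) : Reach R R :=
  Relation.ReflTransGen.refl

/-- `Reach` is transitive (composition of sequences of permissible transforms, p19 L24–27
"`V_n → V_{n−1} → ⋯ → V_1 → V`" — the field `reach_trans` of `Sig56`). [cite: Cutkosky2009, Thm. 5.6 (p. 19 l. 24–27)] -/
theorem Reach.trans {R R' R'' : ResDatum k} (h : Reach R R') (h' : Reach R' R'') : Reach R R'' :=
  Relation.ReflTransGen.trans h h'

/-- A single permissible transform is a sequence (of length one). [cite: Cutkosky2009, Def. 5.5 (p. 18 l. 47–48) with p. 19 l. 24–27] -/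
theorem Step.reach {R R' : ResDatum k} (h : Step R R') : Reach R R' :=
  Relation.ReflTransGen.single h

/-- **`R'` is reached from `R` by a finite sequence of permissible transforms whose centres all satisfy
the rule `P`** ("by applying the following algorithm", p24 L16–22 for (9), p24 L38–44 for (10)): the
reflexive–transitive closure of "one permissible transform along a centre `C` of `R` with `P R C`".
With `P = fun _ _ => True` this is `Reach` (`reachBy_top_iff`). [cite: Cutkosky2009, §8 (p. 24 l. 16–22, l. 38–44)] -/
def ReachBy (P : ∀ R : ResDatum k, R.V.IdealSheafData → Prop) (R R' : ResDatum k) : Prop :=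
  Relation.ReflTransGen
    (fun R₁ R₂ : ResDatum k => ∃ (C : R₁.V.IdealSheafData) (τ : R₂.V ⟶ R₁.V), P R₁ C ∧ IsTransform R₁ R₂ C τ)
    R R'

/-- A sequence following the rule `P` is a sequence of permissible transforms. [cite: Cutkosky2009, §8 (p. 24 l. 16–22)] -/
theorem ReachBy.reach {P : ∀ R : ResDatum k, R.V.IdealSheafData → Prop} {R R' : ResDatum k}
    (h : ReachBy P R R') : Reach R R' := by
  induction h with
  | refl => exact Relation.ReflTransGen.refl
  | tail _ hst ih =>
    obtain ⟨C, τ, _, hT⟩ := hst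
    exact Relation.ReflTransGen.tail ih ⟨C, τ, hT⟩

/-- With the trivial rule, `ReachBy` is `Reach`. [cite: Cutkosky2009, Thm. 5.6 (p. 19 l. 13–16)] -/
theorem reachBy_top_iff {R R' : ResDatum k} : ReachBy (fun _ _ => True) R R' ↔ Reach R R' := by
  refine ⟨ReachBy.reach, fun h => ?_⟩
  induction h with
  | refl => exact Relation.ReflTransGen.refl
  | tail _ hst ih =>
    obtain ⟨C, τ, hT⟩ := hst
    exact Relation.ReflTransGen.tail ih ⟨C, τ, trivial, hT⟩

/-- **`Y` is an irreducible component of `Sing_r(R)`** (p24 L7 "Suppose that `Y ⊂ Sing_r(R)` is an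
irreducible component"): a closed irreducible subset of `Sing_r(R)`, maximal among the irreducible
subsets of `Sing_r(R)`. [cite: Cutkosky2009, §8 (p. 24 l. 7)] -/
def IsComponentOfSingR (R : ResDatum k) (Y : Closeds R.V) : Prop :=
  (Y : Set R.V) ⊆ R.singR ∧ IsIrreducible (Y : Set R.V) ∧
    ∀ Z : Set R.V, IsIrreducible Z → (Y : Set R.V) ⊆ Z → Z ⊆ R.singR → Z ⊆ Y

/-- An irreducible component of `Sing_r(R)` is nonempty and lies in `Sing_r(R)`. [cite: Cutkosky2009, §8 (p. 24 l. 7)] -/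
theorem IsComponentOfSingR.nonempty {R : ResDatum k} {Y : Closeds R.V} (h : R.IsComponentOfSingR Y) :
    (Y : Set R.V).Nonempty ∧ (Y : Set R.V) ⊆ R.singR :=
  ⟨h.2.1.nonempty, h.1⟩

/-! ### Theorem 7.2's conclusions -/

/-- **Thm. 7.2 (4) at the point `x`, expansion-free: "there exists an approximate hypersurface
`D_p` of `I` at `p` which is transversal to `E⁺` and is not a component of `E⁺`"** — there is a
regular system of parameters `u = (u_1, …, u_d)` of `𝒪_{V,x}` and an index `i₀` (`D_p = V(u_{i₀})`)
such that (a) each member of `E⁺` through `x` has stalk `(u_j)` for some `j ≠ i₀`, distinct members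
getting distinct `j` (`D_p` transversal to `E⁺`, p16 L48–51, and not a component of it), and (b) the
coordinate linear form `X_{i₀}` lies in the directrix `T(cl_r(I_x))` of the degree-`r` initial forms
of `I_x` in the coordinates `u` — i.e. `V(u_{i₀}) ⊇ M_p = V(T)`, "`D_p` contains an approximate
manifold `M_p` to `I` at `p`" (p18 L21–22; `T` = "the smallest linear subspace … such that `L ∈ k[T]`
for all `f ∈ I_p`", p17 L35–40, = `directrix`). [cite: Cutkosky2009, Thm. 7.2 (4) (p. 21 l. 20–21) with p. 18 l. 21–22, p. 17 l. 35–40] -/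
def IsApproxHypersurfaceTransversal (R : ResDatum k) (x : R.V) : Prop :=
  ∃ (u : Fin (maximalIdeal (R.V.presheaf.stalk x)).spanFinrank → R.V.presheaf.stalk x)
    (i₀ : Fin (maximalIdeal (R.V.presheaf.stalk x)).spanFinrank),
    Ideal.span (Set.range u) = maximalIdeal (R.V.presheaf.stalk x) ∧
    (∃ j : {D // D ∈ R.Eplus ∧ x ∈ D.support} → Fin (maximalIdeal (R.V.presheaf.stalk x)).spanFinrank,
      Function.Injective j ∧ (∀ D, j D ≠ i₀) ∧ ∀ D, stalkIdeal D.1 x = Ideal.span {u (j D)}) ∧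
    (LinearMap.proj i₀ : Module.Dual (ResidueField (R.V.presheaf.stalk x))
        (Fin (maximalIdeal (R.V.presheaf.stalk x)).spanFinrank → ResidueField (R.V.presheaf.stalk x))) ∈
      directrix (ResidueField (R.V.presheaf.stalk x))
        (initialForms u (stalkIdeal R.ideal x) R.r :
          Set (MvPolynomial (Fin (maximalIdeal (R.V.presheaf.stalk x)).spanFinrank)
            (ResidueField (R.V.presheaf.stalk x))))

/-- **The conclusions (1)–(4) of Thm. 7.2 hold for `R`** (p21 L15–21; the standing situation of §8,
p24 L5–6, for a datum with arbitrary `E⁺`): (1) `Sing_r(R) ∩ E⁻ = ∅`; (2) `Sing_r(R) ⊆ E⁺` and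
`dim Sing_r(R) ≤ 1`; (3) every irreducible curve contained in `Sing_r(R)` is nonsingular (regular
with its reduced structure); (4) at every closed point of `Sing_r(R)` there is an approximate
hypersurface transversal to `E⁺` and not a component of `E⁺` (`IsApproxHypersurfaceTransversal`).
This is the `Stable` slot of `Sig56`. [cite: Cutkosky2009, Thm. 7.2 (1)–(4) (p. 21 l. 15–21)] -/
def Stable (R : ResDatum k) : Prop :=
  (∀ x ∈ R.singR, ∀ D ∈ R.Eminus, x ∉ (D.support : Set R.V)) ∧
  (∀ x ∈ R.singR, ∃ D ∈ R.Eplus, x ∈ (D.support : Set R.V)) ∧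
  topologicalKrullDim R.singR ≤ 1 ∧
  (∀ Z : Closeds R.V, (Z : Set R.V) ⊆ R.singR → IsIrreducible (Z : Set R.V) →
    topologicalKrullDim (Z : Set R.V) = 1 →
      Scheme.IsRegular (AlgebraicGeometry.Scheme.IdealSheafData.vanishingIdeal Z).subscheme) ∧
  (∀ x ∈ R.singR, IsClosed ({x} : Set R.V) → R.IsApproxHypersurfaceTransversal x)

/-! ### The number `η(p)`, kinds of centres, and infinite runs (for the procedural statements of §§7–8) -/

/-- **`η(p)` = the number of components of `E⁻` containing `p`** (p18 L41–43). [cite: Cutkosky2009, Def. 5.4 (p. 18 l. 41–43)] -/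
def eta (R : ResDatum k) (x : R.V) : ℕ :=
  Set.ncard {D : R.V.IdealSheafData | D ∈ R.Eminus ∧ x ∈ (D.support : Set R.V)}

/-- The centre `V(C)` is a (closed) POINT: its support is a single closed point (the centres of
§8 (9) Step 2 "blow up a point in `Sing_r(R_n)`", p24 L21–22, and of the point blow-ups in the
proof of Thm. 7.2). [cite: Cutkosky2009, §8 (9) (p. 24 l. 21–22)] -/
def IsPointCentre (R : ResDatum k) (C : R.V.IdealSheafData) : Prop :=
  ∃ x : R.V, IsClosed ({x} : Set R.V) ∧ (C.support : Set R.V) = {x}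

/-- The centre `V(C)` is an IRREDUCIBLE CURVE: its support is irreducible of dimension one (the
centres of §8 (9) Step 1 "If there exists an irreducible curve `C ⊂ Sing_r(R_n)` then perform the
permissible transform `V_{n+1} → V_n` obtained by blowing up `C`", p24 L19–21).
[cite: Cutkosky2009, §8 (9) (p. 24 l. 19–21)] -/
def IsCurveCentre (R : ResDatum k) (C : R.V.IdealSheafData) : Prop :=
  IsIrreducible (C.support : Set R.V) ∧ topologicalKrullDim (C.support : Set R.V) = 1

/-! ### Unfolding -/

/-- A resolved datum has finite (empty) singular locus ("If the sequence (10) is of finite length,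
then we have achieved the conclusions of Theorem 5.6", p24 L50–51: the stopping state `Sing_r = ∅`
of §8). [cite: Cutkosky2009, §8 (p. 24 l. 38–51)] -/
theorem Resolved.finSing {R : ResDatum k} (h : R.Resolved) : R.FinSing := by
  rw [FinSing, h]
  exact Set.finite_empty

/-- A resolved datum is stable: all four conclusions of Thm. 7.2 quantify over `Sing_r(R)`, and
`dim ∅ ≤ 1` (the vacuous case of Thm. 7.2). [cite: Cutkosky2009, Thm. 7.2 (1)–(4) (p. 21 l. 15–21), case `Sing_r = ∅`] -/
theorem Resolved.stable {R : ResDatum k} (h : R.Resolved) : R.Stable := by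
  refine ⟨fun x hx => ?_, fun x hx => ?_, ?_, fun Z hZ hirr _ => ?_, fun x hx => ?_⟩
  · rw [Resolved] at h; rw [h] at hx; exact hx.elim
  · rw [Resolved] at h; rw [h] at hx; exact hx.elim
  · rw [Resolved] at h
    rw [h]
    haveI : IsEmpty (IrreducibleCloseds (∅ : Set R.V)) :=
      ⟨fun Z => Z.isIrreducible.nonempty.elim fun a _ => a.2.elim⟩
    rw [topologicalKrullDim, Order.krullDim_eq_bot]
    exact bot_le
  · rw [Resolved] at h
    rw [h, Set.subset_empty_iff] at hZ
    exact absurd (hZ ▸ hirr.nonempty) Set.not_nonempty_empty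
  · rw [Resolved] at h; rw [h] at hx; exact hx.elim

end ResDatum

/-- **An infinite run of permissible transforms** `⋯ → V_{n+1} → V_n → ⋯ → V_0` with its centres
and blow-up maps as DATA (the shape of the sequences (6), (9), (10), (11) of §§7–8 when they do not
stop): `datum n = R_n`, `centre n = C_n ⊆ Sing_r(R_n)`, `map n : V_{n+1} → V_n` the blow-up of
`C_n`, `R_{n+1}` the transform of `R_n`. The procedural statements of §§7–8 are non-existence /
finiteness statements about such runs. [cite: Cutkosky2009, §8 (9)–(10) (p. 24 l. 14–45)] -/
structure Run where
  /-- the data `R_n` -/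
  datum : ℕ → ResDatum k
  /-- the centres `C_n` -/
  centre : ∀ n, (datum n).V.IdealSheafData
  /-- the blow-ups `V_{n+1} → V_n` -/
  map : ∀ n, (datum (n + 1)).V ⟶ (datum n).V
  /-- `R_{n+1}` is the transform of `R_n` along the blow-up of `C_n` -/
  isTransform : ∀ n, (datum n).IsTransform (datum (n + 1)) (centre n) (map n)

variable {k} in
/-- Every stage of a run is reached from the start. [cite: Cutkosky2009, Thm. 5.6 (p. 19 l. 24–27)] -/
theorem Run.reach (ρ : Run k) (n : ℕ) : (ρ.datum 0).Reach (ρ.datum n) := by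
  induction n with
  | zero => exact ResDatum.Reach.refl _
  | succ n ih => exact ih.trans (ResDatum.Step.reach ⟨ρ.centre n, ρ.map n, ρ.isTransform n⟩)

end Cutkosky2009

end Literature.AlgebraicGeometry.Resolution

end
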